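import Summits.QuantumFields.YangMills.Theorems.FluctuationComparisonRegPrIntLS2BetaLiftLadderFaceRow
import Summits.QuantumFields.YangMills.Theorems.FluctuationComparisonRegPrIntLS2BetaRelativeLiftFactorisationEps
import Summits.QuantumFields.YangMills.Theorems.FluctuationComparisonRegPrIntLS2BetaTildePlaquetteComparison
import Summits.QuantumFields.YangMills.Theorems.FluctuationComparisonRegPrIntLS2BetaDistributedHolonomySU2
import HarnessLib

/-!
# S2β · THE SUP CHAIN, (RSP-Σ)'s PER-LEVEL ROW (architect rulings 19:37:59Z ∕ 19:55:50Z (iii): «(RSP) → (RSP-Σ): `s_{j+1} ≤ (c∕L)s_j + C·L²·2θ_j`, holder px12»):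
# THE SUP STEP AT EVERY INTRA-BLOCK BOND — `‖log η_b‖ ≤ 11∕10·L⁻¹·m + (π∕2)·ℓ_B(b)·ρ̃`, and `ρ̃` from ABSOLUTE plaquette sizes plus MIXED prices (✓p832842)

Cell `ym3-torus` (YM ladder rung R3 = continuum `SU(2)` Yang–Mills on the three-torus at fixed lattice data — a RUNG: NOT d = 4, NOT infinite volume, NOT a mass gap,
NOT Clay).  Width seat «width 12» `ym3-torus-px12` (gen 26), FREE px helper on crux `stmt-QuantumFields-20520`; `--kind proof --supports stmt-QuantumFields-20520 --as
helper`, count-neutral, DEFINITION-FREE (0 `def`, 0 `instance`, 0 `notation`, 0 `sorry`, default heartbeats).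

WHAT IT COMPOSES (all landed).  px20 g24 ✓p832421 `…LiftLadderFaceRow.norm_logVec_rawChord_le_lift_add_disc` (ANY bond: `‖log η̄_b‖ ≤ 11∕10·L⁻¹·m + ‖log ε′_b‖`, `ε′ = R⁻¹η` read
on the left), px21 g24 ✓p832278 `…RelativeLiftFactorisationEps.dist1_eps_le_of_intraBlock` (INTRA-BLOCK bond `⟨y,e⟩`: `dist1 ε ≤ ℓ_B(y,e)·ρ̃` from the two comb-axial tree
identities and `hρ`), this seat's ✓p832842 `…TildePlaquetteComparison.dist1_plaqHol_tilde_rel_le` (`ρ̃ ≤` stage-pair + lifts' relative plaquettes + mixed), the conjugacy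
`ε′ = U·ε·U⁻¹` (✓`norm_logVec_su2Quat_conj`) and `‖log‖ ≤ (π∕2)·dist1` (✓`…DistributedHolonomySU2.norm_logVec_le_pi_div_two_mul_dist1`).

WHAT IS PROVED (sorry-free).
§1 ★`rhoTilde_le_of_abs` — any `GaugeGroup` with the commutator letter `hcomm`: with ABSOLUTE plaquette sizes `dist1 □U, dist1 □W ≤ θ`, `dist1 □A_U, dist1 □A_W ≤ θA`
   and bond sizes `s, τ, m` on the plaquette: `dist1 ((□W̃)⁻¹·□W) ≤ 2θ + 2θA + 2(4s+θ)m + 2(4τ+θA)m` — (RSP-Σ)'s SOURCE is absolute (`2θ` «from both fields ∈ histGood»,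
   ruling 19:27:44Z∕19:55:50Z), so on THIS road no relative-lift-curvature letter is needed.
§2 ★★★`norm_logVec_rawChord_le_of_intraBlock` — THE SUP STEP AT AN INTRA-BLOCK BOND, in px20's `AxStage`∕raw-tower currency (`av, wt, lift, g, g₀, U, U₁, U₀`,
   `hwt, hlift, hT3 ×4, hU₀` VERBATIM from ✓p832421) plus px21's two tree-identity rows `hTU`, `hTU₁` (the (T4) identities at level `j` for the two stage fields inside
   block `B`) and the `ρ̃` row `hρ` (✓p832278's VERBATIM, fed by §1∕✓p832842):
   **`‖log (Ū_j b·(Ū₀_j b)⁻¹)‖ ≤ 11∕10·(L⁻¹·m) + π∕2·(ℓ_B(y,e)·ρ̃)`**, `b = ⟨y,e⟩`, `ℓ_B(y,e) = Σ_{ν<e} |rel (emb B) y ν|` (`≤ e·(L−1)∕2`, ✓`dist1_eps_le_of_intraBlock'`).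
READING.  Per level: `s_fine ≤ 11∕10·L⁻¹·s_coarse + (π∕2)·ℓ_lad·ρ̃`, `ρ̃ ≤ 2θ_f + 2θ_A + O(σ·L⁻¹·s_coarse)` — the `O(σ)` FEEDBACK into the contraction coefficient is the honest
price of the intra-block ladder (contraction wants the arc profile `σ` small, sharper than `1∕4`; near-top levels excluded via `c_t` as ruled).  Face-crossing bonds are NOT
covered here (px20's face row).

HONEST SCOPE.  A composition of landed letters; the sizes `σ, m, θ, θA, ρ̃`, the tree identities and the gauge rows are HYPOTHESES; nothing of Bałaban's renormalisation-group
analysis is asserted or proved ([Balaban1985Averaging] (8)–(9) p.19, (58) p.27; [Balaban1989LargeFieldII] p.382 — the printed intra-block ladder); the face row, the sharper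
arc profile, the tower discharge of (RSP-Σ) (px21's engine), OSC-lift, NC-ROW′∕COMB-ROW′'s per-`B` assembly, (ST″), LOC, GAP♯∘ (`stub_uniformFibreGapOrbit`, registry 3732b7df
UNTOUCHED), the five registered stubs (0∕5), S2β, 20520, 19936, 19200, `YM3TorusSU2` are NOT proved; no registered stub is closed; rung R3 — NOT d = 4, NOT infinite volume,
NOT a mass gap, NOT Clay; the Yang–Mills mass gap is NOT proved.
-/

set_option autoImplicit false

namespace Summit.QuantumFields.YangMills.Theorems.FluctuationComparisonRegPrIntLS2BetaSupStepIntraBlock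

open Finset
open scoped Real
open Literature.MathematicalPhysics.QuantumLattice (su2Quat)
open Literature.MathematicalPhysics.QuantumFieldTheory.Balaban1983to89
open T4Continuum
open B10Eq27TorusAxialLog (rel)
open Literature.MathematicalPhysics.QuantumFieldTheory.Balaban1983to89.BlockAveraging
open T4CubeChartGnomonic (SU2)
open T4HaarSU2ExpChart (expPoint)
open T4ExpWindowSmallField (logVec)
open Summit.QuantumFields.YangMills.Theorems.FluctuationComparisonRegPrIntLS2BetaSmallBondGaugeToronObstruction (norm_logVec_su2Quat_conj)
open Summit.QuantumFields.YangMills.Theorems.FluctuationComparisonRegPrIntLS2BetaLiftLadderFaceRow (norm_logVec_rawChord_le_lift_add_disc)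
open Summit.QuantumFields.YangMills.Theorems.FluctuationComparisonRegPrIntLS2BetaRelativeLiftFactorisationEps (dist1_eps_le_of_intraBlock)
open Summit.QuantumFields.YangMills.Theorems.FluctuationComparisonRegPrIntLS2BetaTildePlaquetteComparison (dist1_plaqHol_tilde_rel_le)
open Summit.QuantumFields.YangMills.Theorems.FluctuationComparisonRegPrIntLS2BetaDistributedHolonomySU2 (norm_logVec_le_pi_div_two_mul_dist1)

variable {P : Params}

/-! ## §1 `ρ̃` from absolute plaquette sizes -/

/-- ★ **`ρ̃` FROM ABSOLUTE SIZES** (any `GaugeGroup`, commutator letter `hcomm`): on a plaquette `p` whose four bonds carry `dist1 (U b) ≤ s`, `dist1 (A_U b) ≤ τ`,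
`dist1 ((A_U b)⁻¹·A_W b) ≤ m`, and whose plaquettes satisfy `dist1 □U, dist1 □W ≤ θ`, `dist1 □A_U, dist1 □A_W ≤ θA`:
`dist1 ((□W̃)⁻¹·□W) ≤ 2θ + 2θA + 2(4s+θ)m + 2(4τ+θA)m` (✓p832842 + two triangle inequalities). [cite: Balaban1985Averaging, (8)-(9) p.19] -/
theorem rhoTilde_le_of_abs {j : ℕ} {G : Type*} [GaugeGroup G] (hcomm : ∀ g h : G, dist1 (g * h * g⁻¹ * h⁻¹) ≤ 2 * dist1 g * dist1 h)
    (U W A_U A_W : GaugeField P j G) (p : Plaq P j) {s τ m θ θA : ℝ} (hs0 : 0 ≤ s) (hτ0 : 0 ≤ τ) (hm0 : 0 ≤ m)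
    (hs : ∀ b : PBond P j, b = ⟨p.src, p.μ⟩ ∨ b = ⟨p.src.shift p.μ, p.ν⟩ ∨ b = ⟨p.src.shift p.ν, p.μ⟩ ∨ b = ⟨p.src, p.ν⟩ → dist1 (U b) ≤ s)
    (hτ : ∀ b : PBond P j, b = ⟨p.src, p.μ⟩ ∨ b = ⟨p.src.shift p.μ, p.ν⟩ ∨ b = ⟨p.src.shift p.ν, p.μ⟩ ∨ b = ⟨p.src, p.ν⟩ → dist1 (A_U b) ≤ τ)
    (hm : ∀ b : PBond P j, b = ⟨p.src, p.μ⟩ ∨ b = ⟨p.src.shift p.μ, p.ν⟩ ∨ b = ⟨p.src.shift p.ν, p.μ⟩ ∨ b = ⟨p.src, p.ν⟩ → dist1 ((A_U b)⁻¹ * A_W b) ≤ m)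
    (hθU : dist1 (GaugeField.plaqHol U p) ≤ θ) (hθW : dist1 (GaugeField.plaqHol W p) ≤ θ)
    (hθAU : dist1 (GaugeField.plaqHol A_U p) ≤ θA) (hθAW : dist1 (GaugeField.plaqHol A_W p) ≤ θA) :
    dist1 ((GaugeField.plaqHol (fun b => A_W b * ((A_U b)⁻¹ * U b)) p)⁻¹ * GaugeField.plaqHol W p) ≤
      2 * θ + 2 * θA + 2 * (4 * s + θ) * m + 2 * (4 * τ + θA) * m := by
  have h := dist1_plaqHol_tilde_rel_le hcomm U W A_U A_W p hs0 hτ0 hm0 hs hτ hm hθU hθAU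
  have h1 : dist1 ((GaugeField.plaqHol U p)⁻¹ * GaugeField.plaqHol W p) ≤ θ + θ := by
    have := GaugeGroup.dist1_mul_le (GaugeField.plaqHol U p)⁻¹ (GaugeField.plaqHol W p)
    rw [GaugeGroup.dist1_inv] at this
    linarith
  have h2 : dist1 (GaugeField.plaqHol A_W p * (GaugeField.plaqHol A_U p)⁻¹) ≤ θA + θA := by
    have := GaugeGroup.dist1_mul_le (GaugeField.plaqHol A_W p) (GaugeField.plaqHol A_U p)⁻¹
    rw [GaugeGroup.dist1_inv] at this
    linarith
  linarith

/-- The two readings of the discrepancy are conjugate: `(aW·aU⁻¹)⁻¹·(w·u⁻¹) = u·((aW·(aU⁻¹·u))⁻¹·w)·u⁻¹`. [folklore] -/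
theorem disc_left_eq_conj_disc_right {G : Type*} [Group G] (aU aW u w : G) :
    (aW * aU⁻¹)⁻¹ * (w * u⁻¹) = u * ((aW * (aU⁻¹ * u))⁻¹ * w) * u⁻¹ := by
  group

/-! ## §2 The sup step at an intra-block bond -/

/-- ★★★ **THE SUP STEP AT AN INTRA-BLOCK BOND** ((RSP-Σ)'s per-level row, one bond): in px20's raw-tower currency (hypotheses `hwt … hU₀`, `hσ hσ′ hm` VERBATIM from
✓p832421 `norm_logVec_rawChord_le_lift_add_disc`), with px21's two comb-axial tree-identity rows at level `j` inside block `B` for the two STAGE-gauge fields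
(`hTU` for `g_j·Ū_j` against its lift, `hTU₁` for `g₀_j·Ū₁_j`), and the `ρ̃` row `hρ` (✓p832278's, base pair `(A_U, U) :=` the `U₁`-tower, partner `(A_W, W) :=`
the `U`-tower): for `b = ⟨y, e⟩` with `y, y+e ∈ B`,
`‖log (Ū_j b·(Ū₀_j b)⁻¹)‖ ≤ 11∕10·(L⁻¹·m) + π∕2·(ℓ_B(y,e)·ρ̃)`, `ℓ_B(y,e) = Σ_{ν<e} |rel (emb B) y ν|`.
[cite: Balaban1985Averaging, (8)-(9) p.19, (58) p.27; Balaban1989LargeFieldII, p.382] -/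
theorem norm_logVec_rawChord_le_of_intraBlock (av : ∀ i, Averaging P i SU2) {j : ℕ} (hj : j + 1 ≤ P.m + P.K)
    (wt : (i : ℕ) → PBond P i → PBond P (i + 1) → ℝ) (lift : (i : ℕ) → GaugeField P (i + 1) SU2 → GaugeField P i SU2)
    (g g₀ : (i : ℕ) → Site P i → SU2) (U U₁ U₀ : GaugeField P 0 SU2)
    (hwt : ∀ b e, wt j b e = if e.dir = b.dir ∧ (b.src b.dir - emb e.src b.dir).val < P.L then
      ∏ ν ∈ Finset.univ.erase b.dir, max 0 (1 - ((rel (emb e.src) b.src ν).natAbs : ℝ) / P.L) else 0)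
    (hlift : ∀ (X : GaugeField P (j + 1) SU2) (b : PBond P j), lift j X b = expPoint (∑ e, wt j b e • ((P.L : ℝ)⁻¹ • logVec (su2Quat (X e)))))
    (hT3 : ∀ X : GaugeField P 0 SU2, Averaging.iter av j (GaugeField.gaugeAct (g 0) X) = GaugeField.gaugeAct (g j) (Averaging.iter av j X))
    (hT3s : ∀ X : GaugeField P 0 SU2, Averaging.iter av (j + 1) (GaugeField.gaugeAct (g 0) X) = GaugeField.gaugeAct (g (j + 1)) (Averaging.iter av (j + 1) X))
    (hT3' : ∀ X : GaugeField P 0 SU2, Averaging.iter av j (GaugeField.gaugeAct (g₀ 0) X) = GaugeField.gaugeAct (g₀ j) (Averaging.iter av j X))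
    (hT3s' : ∀ X : GaugeField P 0 SU2, Averaging.iter av (j + 1) (GaugeField.gaugeAct (g₀ 0) X) = GaugeField.gaugeAct (g₀ (j + 1)) (Averaging.iter av (j + 1) X))
    (hU₀ : U₀ = GaugeField.gaugeAct (fun x => (g 0 x)⁻¹ * g₀ 0 x) U₁)
    (B : Site P (j + 1))
    (hTU : ∀ (x : Site P j) (μ : Fin P.d), blockOf x = B → blockOf (x.shift μ) = B → (∀ ν, ν < μ → rel (emb B) x ν = 0) →
      GaugeField.gaugeAct (g j) (Averaging.iter av j U) ⟨x, μ⟩ = lift j (GaugeField.gaugeAct (g (j + 1)) (Averaging.iter av (j + 1) U)) ⟨x, μ⟩)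
    (hTU₁ : ∀ (x : Site P j) (μ : Fin P.d), blockOf x = B → blockOf (x.shift μ) = B → (∀ ν, ν < μ → rel (emb B) x ν = 0) →
      GaugeField.gaugeAct (g₀ j) (Averaging.iter av j U₁) ⟨x, μ⟩ = lift j (GaugeField.gaugeAct (g₀ (j + 1)) (Averaging.iter av (j + 1) U₁)) ⟨x, μ⟩)
    {ρ : ℝ} (hρ0 : 0 ≤ ρ)
    (hρ : ∀ q : Plaq P j, blockOf q.src = B →
      dist1 ((GaugeField.plaqHol (fun b => lift j (GaugeField.gaugeAct (g (j + 1)) (Averaging.iter av (j + 1) U)) b *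
          ((lift j (GaugeField.gaugeAct (g₀ (j + 1)) (Averaging.iter av (j + 1) U₁)) b)⁻¹ * GaugeField.gaugeAct (g₀ j) (Averaging.iter av j U₁) b) :
            GaugeField P j SU2) q)⁻¹ *
        GaugeField.plaqHol (GaugeField.gaugeAct (g j) (Averaging.iter av j U)) q) ≤ ρ)
    (y : Site P j) (e : Fin P.d) (hy : blockOf y = B) (hye : blockOf (y.shift e) = B)
    {σ m : ℝ} (hL2 : 2 ≤ P.L) (hσ4 : σ ≤ 1 / 4)
    (hσ : ∀ e', wt j ⟨y, e⟩ e' ≠ 0 → ‖logVec (su2Quat (GaugeField.gaugeAct (g (j + 1)) (Averaging.iter av (j + 1) U) e'))‖ ≤ σ)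
    (hσ' : ∀ e', wt j ⟨y, e⟩ e' ≠ 0 → ‖logVec (su2Quat (GaugeField.gaugeAct (g₀ (j + 1)) (Averaging.iter av (j + 1) U₁) e'))‖ ≤ σ)
    (hm : ∀ e', wt j ⟨y, e⟩ e' ≠ 0 → ‖logVec (su2Quat (Averaging.iter av (j + 1) U e' * (Averaging.iter av (j + 1) U₀ e')⁻¹))‖ ≤ m) :
    ‖logVec (su2Quat (Averaging.iter av j U ⟨y, e⟩ * (Averaging.iter av j U₀ ⟨y, e⟩)⁻¹))‖ ≤
      11 / 10 * ((P.L : ℝ)⁻¹ * m) + π / 2 * ((∑ ν ∈ Finset.univ.filter (fun ν => ν < e), ((rel (emb B) y ν).natAbs : ℝ)) * ρ) := by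
  -- px20's face row: raw chord ≤ lift part + discrepancy (read on the left)
  have h1 := norm_logVec_rawChord_le_lift_add_disc av hj wt lift g g₀ U U₁ U₀ hwt hlift hT3 hT3s hT3' hT3s' hU₀ ⟨y, e⟩ hL2 hσ4 hσ hσ' hm
  -- px21's intra-block ladder: the discrepancy read on the right (base pair = the `U₁`-tower, partner = the `U`-tower)
  have h2 := dist1_eps_le_of_intraBlock hj (lift j (GaugeField.gaugeAct (g₀ (j + 1)) (Averaging.iter av (j + 1) U₁))) (lift j (GaugeField.gaugeAct (g (j + 1)) (Averaging.iter av (j + 1) U))) (GaugeField.gaugeAct (g₀ j) (Averaging.iter av j U₁)) (GaugeField.gaugeAct (g j) (Averaging.iter av j U)) B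
    (fun x μ hx hxs hlo => hTU₁ x μ hx hxs hlo) (fun x μ hx hxs hlo => hTU x μ hx hxs hlo) hρ0 hρ y e hy hye
  -- the two discrepancies are conjugate: `ε′ = u·ε·u⁻¹`
  have hconj : ‖logVec (su2Quat ((lift j (GaugeField.gaugeAct (g (j + 1)) (Averaging.iter av (j + 1) U)) ⟨y, e⟩ * (lift j (GaugeField.gaugeAct (g₀ (j + 1)) (Averaging.iter av (j + 1) U₁)) ⟨y, e⟩)⁻¹)⁻¹ * (GaugeField.gaugeAct (g j) (Averaging.iter av j U) ⟨y, e⟩ * (GaugeField.gaugeAct (g₀ j) (Averaging.iter av j U₁) ⟨y, e⟩)⁻¹)))‖ =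
      ‖logVec (su2Quat ((lift j (GaugeField.gaugeAct (g (j + 1)) (Averaging.iter av (j + 1) U)) ⟨y, e⟩ * ((lift j (GaugeField.gaugeAct (g₀ (j + 1)) (Averaging.iter av (j + 1) U₁)) ⟨y, e⟩)⁻¹ * GaugeField.gaugeAct (g₀ j) (Averaging.iter av j U₁) ⟨y, e⟩))⁻¹ * GaugeField.gaugeAct (g j) (Averaging.iter av j U) ⟨y, e⟩))‖ := by
    rw [disc_left_eq_conj_disc_right, norm_logVec_su2Quat_conj]
  -- arc from chord for the discrepancy
  have h3 := norm_logVec_le_pi_div_two_mul_dist1 ((lift j (GaugeField.gaugeAct (g (j + 1)) (Averaging.iter av (j + 1) U)) ⟨y, e⟩ * ((lift j (GaugeField.gaugeAct (g₀ (j + 1)) (Averaging.iter av (j + 1) U₁)) ⟨y, e⟩)⁻¹ * GaugeField.gaugeAct (g₀ j) (Averaging.iter av j U₁) ⟨y, e⟩))⁻¹ * GaugeField.gaugeAct (g j) (Averaging.iter av j U) ⟨y, e⟩)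
  have hπ : 0 ≤ π / 2 := by positivity
  have h4 := h3.trans (mul_le_mul_of_nonneg_left h2 hπ)
  have h5 := hconj.trans_le h4
  linarith [h1, h5]

end Summit.QuantumFields.YangMills.Theorems.FluctuationComparisonRegPrIntLS2BetaSupStepIntraBlock
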